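import Summits.ResolutionOfSingularities.ResolutionOfSingularities.Theorems.PurelyInseparableDim4ResCone
import Summits.ResolutionOfSingularities.ResolutionOfSingularities.Theorems.PurelyInseparableDim4Straightening
import Mathlib.Algebra.MvPolynomial.NoZeroDivisors
import HarnessLib
import HarnessLib.Audit.Tags

/-!
# Purely inseparable four-folds — tame-cone bookkeeping: the chart-origin map on monomials and the
# `x_j`-degree of sheared monomials (FILE 2a of the I-4-6 (VT) typing, cell `res-dim4-pi`, K2(p) lane)

[OURS · counted 0 · cell `res-dim4-pi` · desk WORD #55 (a), crit-4 g2 V-A4-13 GO · seat res-dim4-p-12 g2.]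
Nothing here proves K2(p), `NoIsolatedTrap p p` or resolution of singularities in dimension ≥ 4 /
characteristic `p`.  Elementary lemmas consumed by `…ResConeNear` ((VT)(i)(iv)):

* §0 (p-8 g2 K-P8-01): on boundary-free states (`r = 0`) `resForm s = in F` and
  `finrank (resVertex s) = RidgeBudget.ebar s.F` — the census' `ē` rows are `e_G` rows.
* §1 the chart-ORIGIN transform at the point centre is injective on monomials
  (`coeff_chartTransform_chartExponent`, via `PointBlowup.chartExponent_injective`) and
  `|e′| + q + e_j = 2|e|` (`degree_chartExponent_univ`), `e′_j = |e| − q`.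
* §2 `degreeOf j` under Hauser's shear: `degreeOf_shear_X`, **`degreeOf_shear_monomial`**
  (`degreeOf_j (shear j t (x^r)) = Σ_i r_i·[i = j ∨ t_i ≠ 0] = r_j + Σ_{translated} r_i`).
bears_on: LADDER-RESOLUTION:D157-DOOR2 (res-dim4-pi · K2(p) · I-4-6 letters).  Supports
stmt-ResolutionOfSingularities-16155 (helper).
-/

set_option linter.dupNamespace false -- mandated namespace of this single-conjunct summit

noncomputable section

namespace Summit.ResolutionOfSingularities.ResolutionOfSingularities.Theorems.PIDim4

namespace ResCone

open MvPolynomial Finset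
open Literature.AlgebraicGeometry.Resolution
open Literature.AlgebraicGeometry.Resolution.CentreBlowup
open Literature.AlgebraicGeometry.Resolution.Hauser2010
open Literature.AlgebraicGeometry.Resolution.HauserPerlega2019
open PointBlowup (polarMap additiveSubspace direction)

variable {K : Type} [Field K]

/-! ## 0. Dictionary on boundary-free states: `g = in F`, `e_G = ē` when `r = 0` (p-8 g2 K-P8-01) -/

/-- With no boundary (`r = 0`) the residual cone is the initial form of `F`. [folklore] -/
theorem resForm_eq_initialForm_of_r_eq_zero {s : State K} (h : s.r = 0) : resForm s = initialForm s.F := by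
  ext e
  rw [coeff_resForm, h, zero_add]

/-- With no boundary the tame-cone vertex is the additive subspace of the initial form of `F`. [folklore] -/
theorem resVertex_eq_of_r_eq_zero {s : State K} (h : s.r = 0) :
    resVertex s = additiveSubspace (initialForm s.F) := by
  unfold resVertex
  rw [resForm_eq_initialForm_of_r_eq_zero h]

/-- With no boundary `e_G = ē` (`RidgeBudget.ebar`): the census' `ē = 2` rows are `e_G = 2` rows. [folklore] -/
theorem finrank_resVertex_eq_ebar {s : State K} (h : s.r = 0) :
    Module.finrank K (resVertex s) = RidgeBudget.ebar s.F := by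
  rw [resVertex_eq_of_r_eq_zero h]
  rfl

/-! ## 1. The chart-origin transform at `S = univ`: coefficients and degrees -/

/-- Monomials of a polynomial of order `≥ q` along the point centre have degree `≥ q`. [folklore] -/
theorem le_degree_of_mem_support {q : ℕ} {F : MvPolynomial (Fin 4) K}
    (hq : (q : ℕ∞) ≤ ordAlong Finset.univ F) {d : Fin 4 →₀ ℕ} (hd : d ∈ F.support) : q ≤ d.degree := by
  have h := (le_ordAlong_iff.mp hq) d hd
  rw [degIn_univ] at h
  exact_mod_cast h

/-- **The chart map is injective on monomials**: the coefficient of `x^{e′}`, `e′ = chartExponent e`, in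
the chart-origin transform of `F` is the coefficient of `x^e` in `F` (all monomials of `F` of degree
`≥ q`). [folklore] -/
theorem coeff_chartTransform_chartExponent {q : ℕ} {j : Fin 4} {F : MvPolynomial (Fin 4) K}
    (hq : (q : ℕ∞) ≤ ordAlong Finset.univ F) {e : Fin 4 →₀ ℕ} (he : e ∈ F.support) :
    coeff (chartExponent q Finset.univ j e) (chartTransform q Finset.univ j F) = coeff e F := by
  classical
  unfold chartTransform
  rw [coeff_sum, Finset.sum_eq_single e]
  · rw [coeff_monomial, if_pos rfl]
  · intro d hd hde
    rw [coeff_monomial, if_neg]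
    intro h
    apply hde
    rw [chartExponent_univ, chartExponent_univ] at h
    exact PointBlowup.chartExponent_injective (le_degree_of_mem_support hq hd)
      (le_degree_of_mem_support hq he) h
  · intro h
    exact absurd he h

/-- Degree of the chart exponent at `S = univ`: `|e′| + q + e_j = 2|e|` (for `q ≤ |e|`). [folklore] -/
theorem degree_chartExponent_univ (q : ℕ) (j : Fin 4) {e : Fin 4 →₀ ℕ} (hq : q ≤ e.degree) :
    (chartExponent q Finset.univ j e).degree + q + e j = 2 * e.degree := by
  unfold chartExponent
  rw [degIn_univ]
  have h := PointBlowup.degree_update_add e j (e.degree - q)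
  omega

/-- The `x_j`-exponent of the chart exponent at `S = univ` is `|e| − q`. [folklore] -/
theorem chartExponent_univ_apply_self (q : ℕ) (j : Fin 4) (e : Fin 4 →₀ ℕ) :
    chartExponent q Finset.univ j e j = e.degree - q := by
  rw [chartExponent_apply_self, degIn_univ]

/-! ## 2. The `x_j`-degree of sheared monomials -/

/-- Shears of non-zero polynomials are non-zero. [folklore] -/
theorem shear_ne_zero (j : Fin 4) {t : Fin 4 → K} (ht : t j = 0) {P : MvPolynomial (Fin 4) K}
    (hP : P ≠ 0) : shear j t P ≠ 0 := fun h => hP ((shear_eq_zero_iff j ht P).mp h)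

/-- `degreeOf j` of a sheared variable: `1` for `x_j` and for the translated `x_i` (`t_i ≠ 0`), else `0`.
[folklore] -/
theorem degreeOf_shear_X [DecidableEq K] (j i : Fin 4) (t : Fin 4 → K) :
    degreeOf j (shear j t (X i : MvPolynomial (Fin 4) K)) = if i = j ∨ t i ≠ 0 then 1 else 0 := by
  classical
  by_cases hij : i = j
  · subst hij
    rw [shear_X_self, degreeOf_X, if_pos rfl, if_pos (Or.inl rfl)]
  · rw [shear_X_of_ne hij]
    by_cases hti : t i = 0
    · rw [hti, C_0, zero_mul, add_zero, degreeOf_X, if_neg (Ne.symm hij), if_neg (by tauto)]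
    · rw [if_pos (Or.inr hti)]
      refine le_antisymm ?_ ?_
      · refine (degreeOf_add_le _ _ _).trans (max_le ?_ ?_)
        · rw [degreeOf_X, if_neg (Ne.symm hij)]; exact Nat.zero_le _
        · refine (degreeOf_C_mul_le _ _ _).trans ?_
          rw [degreeOf_X, if_pos rfl]
      · have hmem : Finsupp.single j 1 ∈ (X i + C (t i) * X j : MvPolynomial (Fin 4) K).support := by
          have hX : coeff (Finsupp.single j 1) (X i : MvPolynomial (Fin 4) K) = 0 := by
            rw [show (X i : MvPolynomial (Fin 4) K) = monomial (Finsupp.single i 1) 1 from rfl, coeff_monomial,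
              if_neg]
            intro h
            have := Finsupp.single_eq_single_iff _ _ _ _ |>.mp h
            rcases this with ⟨h1, -⟩ | ⟨-, h2⟩
            · exact hij h1
            · exact one_ne_zero h2
          rw [MvPolynomial.mem_support_iff, coeff_add, hX, zero_add, coeff_C_mul,
            show (X j : MvPolynomial (Fin 4) K) = monomial (Finsupp.single j 1) 1 from rfl, coeff_monomial,
            if_pos rfl, mul_one]
          exact hti
        have := monomial_le_degreeOf j hmem
        rwa [Finsupp.single_eq_same] at this

/-- **`degreeOf j` of a sheared monomial**: `r_j` plus the multiplicities of the TRANSLATED coordinates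
(`t_i ≠ 0`, the components lost at the point). [folklore] -/
theorem degreeOf_shear_monomial [DecidableEq K] (j : Fin 4) {t : Fin 4 → K} (ht : t j = 0) (r : Fin 4 →₀ ℕ) {c : K}
    (hc : c ≠ 0) :
    degreeOf j (shear j t (monomial r c)) = ∑ i, r i * (if i = j ∨ t i ≠ 0 then 1 else 0) := by
  classical
  rw [monomial_eq, Finsupp.prod_fintype _ _ (fun i => pow_zero _)]
  have hmul : shear j t (C c * ∏ i, (X i : MvPolynomial (Fin 4) K) ^ r i) =
      C c * ∏ i, shear j t (X i) ^ r i := by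
    unfold shear
    rw [map_mul, map_prod, algHom_C, MvPolynomial.algebraMap_eq]
    simp_rw [map_pow]
  rw [hmul, degreeOf_C_mul _ _ (mem_nonZeroDivisors_of_ne_zero hc), degreeOf_prod_eq]
  · refine Finset.sum_congr rfl fun i _ => ?_
    rw [degreeOf_pow_eq _ _ _ (shear_ne_zero j ht (X_ne_zero i)), degreeOf_shear_X]
  · intro i _
    exact pow_ne_zero _ (shear_ne_zero j ht (X_ne_zero i))

end ResCone

end Summit.ResolutionOfSingularities.ResolutionOfSingularities.Theorems.PIDim4

end
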